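import Summits.ResolutionOfSingularities.ResolutionOfSingularities.Theorems.SeparableGaloisGaloisQuotientModelsCalibration
import Literature.AlgebraicGeometry.Resolution.LogRegularEquivariantResolutionHolds
import HarnessLib

/-!
# Crux `GaloisQuotientModels` (stmt-ResolutionOfSingularities-18955), line `inseparability-foliation-quotient`:
# stub `stub_equivariantLogResolution` UNCONDITIONALLY, and the crux from (MD) alone

Route `ResolutionOfSingularities/SeparableGalois`. The registered stub `stub_equivariantLogResolution`
of the line skeleton `Cruxes/GaloisQuotientModels/Lines/inseparability_foliation_quotient.lean`
(equivariant Kato–Nizioł resolution of a log regular scheme with a finite group acting by log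
automorphisms) was landed CONDITIONALLY on the named fact
`IllusieTemkin2014_equivariantLogRegularResolution` (`stub_equivariantLogResolution_of_illusieTemkin2014`,
file `SeparableGaloisGaloisQuotientModelsStubEquivariantLogResolutionOfFact.lean`). That named fact
is now a THEOREM of the tree (`IllusieTemkin2014_equivariantLogRegularResolution_holds`,
`Literature/AlgebraicGeometry/Resolution/LogRegularEquivariantResolutionHolds.lean`: one blowing up
along a `G`-stable resolving ideal sheaf read off the linked regular projective subdivision of the
chart fans, [KempfEtAl1973] II §2 Thm. 11*, Kato 1994 (10.3)/(10.4), with the action lifted by the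
universal property of blowing up). Hence:

* `stub_equivariantLogResolution` — the registered stub BY NAME and signature, with no hypothesis
  beyond the skeleton's;
* `galoisQuotientModels_of_multiplicativeDefect` — **the crux `GaloisQuotientModels` follows from the
  single remaining research stub (MD) `stub_multiplicativeDefect`** (de Jong datum with multiplicative
  inseparability defect), by the landed composition
  `galoisQuotientModels_of_multiplicativeDefect_of_equivariantLogResolution` (p169156).

* `hasSeparableGaloisTop_of_multiplicativeDefect` — scheme by scheme: (MD) for `X` (finite subsets
  of `X` in affine opens) GIVES a regular separable Galois top of `X`
  (`hasSeparableGaloisTop_of_multiplicativeDefect_of_equivariantLogResolution` of the calibration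
  file with (ELR) discharged); with `multiplicativeDefect_of_hasSeparableGaloisTop` (ibid.) the open
  stub (MD) is now EQUIVALENT, scheme by scheme, to the separable Galois alteration problem
  (Abramovich–Oort 2000, Q. 2.13) — unconditionally, no named fact in between.

Nothing here asserts (MD); the crux item stays open on it.
-/

noncomputable section

set_option linter.dupNamespace false

open CategoryTheory AlgebraicGeometry TopologicalSpace
open Literature.AlgebraicGeometry.Resolution
open Literature.AlgebraicGeometry.Motives Literature.AlgebraicGeometry.Motives.RatFn

namespace Summit.ResolutionOfSingularities.ResolutionOfSingularities.Theorems.GaloisQuotientModels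

open Summit.ResolutionOfSingularities.ResolutionOfSingularities.Theses.SeparableGalois (GaloisQuotientModels)

/-- **STUB 4 `stub_equivariantLogResolution` of the line `inseparability-foliation-quotient`, now
UNCONDITIONAL** (its registered statement verbatim): a quasi-compact integral scheme `Z` with a log
regular fs Zariski atlas `𝒜`, a finite group `G` acting through `ρZ` by log automorphisms, all
finite subsets of `Z` in affine opens, admits a regular integral `X'` with a `G`-action `ρ'` and a
`G`-equivariant proper birational dominant `r : X' → Z`, finite subsets of `X'` in affine opens,
`r♯ : K(Z) → K(X')` bijective, `ρ'` faithful when `ρZ` is. Proof: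
`stub_equivariantLogResolution_of_illusieTemkin2014` applied to the theorem
`IllusieTemkin2014_equivariantLogRegularResolution_holds`. [cite: Kato1994, (10.4) with (9.8), (10.3)]
[cite: Niziol2006, Thm. 5.8 and 5.10] [cite: IllusieTemkin2014ExpVIII, Thm. 3.4.9 and 3.4.15] -/
theorem stub_equivariantLogResolution (Z : Scheme.{0}) [IsIntegral Z] [CompactSpace Z]
    (𝒜 : LogAtlas.{0} Z) (G : Type) [Group G] [Finite G] (ρZ : G →* Aut Z) (h𝒜 : 𝒜.IsLogRegular)
    (heqv : IsLogEquivariant 𝒜 ρZ)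
    (haff : ∀ S : Finset Z, ∃ U : Z.Opens, IsAffineOpen U ∧ (↑S : Set Z) ⊆ U) :
    ∃ (X' : Scheme.{0}) (_ : IsIntegral X') (ρ' : G →* Aut X') (r : X' ⟶ Z) (_ : IsDominant r),
      IsProper r ∧ IsBirational r ∧ Scheme.IsRegular X' ∧
      (∀ g : G, (ρ' g).hom ≫ r = r ≫ (ρZ g).hom) ∧
      (∀ S : Finset X', ∃ U : X'.Opens, IsAffineOpen U ∧ (↑S : Set X') ⊆ U) ∧
      Function.Bijective (functionFieldMap r) ∧
      (Function.Injective ρZ → Function.Injective ρ') :=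
  stub_equivariantLogResolution_of_illusieTemkin2014
    IllusieTemkin2014_equivariantLogRegularResolution_holds Z 𝒜 G ρZ h𝒜 heqv haff

/-- **The crux `GaloisQuotientModels` from (MD) alone.** With the equivariant log resolution (ELR)
now a theorem, the landed composition of the line
(`galoisQuotientModels_of_multiplicativeDefect_of_equivariantLogResolution`: de Jong's Galois
alteration, the sandwich model, equivariant resolution of the log regular sandwich, the quotient
model) reduces the crux to its single research stub (MD) = `stub_multiplicativeDefect` (a de Jong
datum whose sandwich models carry a log regular atlas by log automorphisms). (MD) is NOT asserted.
[cite: DeJong1997, Thm. 5.13] [cite: IllusieTemkin2014ExpVIII, Thm. 3.4.9 and 3.4.15] -/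
theorem galoisQuotientModels_of_multiplicativeDefect
    (hMD :
      ∀ (p : ℕ) [Fact p.Prime] (k : Type) [Field k] [CharP k p] [PerfectField k]
      (X : Scheme.{0}) [IsIntegral X] (f : X ⟶ Spec (.of k)) [IsSeparated f]
      [LocallyOfFiniteType f] [QuasiCompact f],
      ∃ (G : Type) (_ : Group G) (_ : Finite G) (X₁ : Scheme.{0}) (_ : IsIntegral X₁)
      (ρ : G →* Aut X₁) (π : X₁ ⟶ X) (_ : IsDominant π) (n : ℕ),
      IsGaloisAlterationOfExponent p n ρ π ∧
      ∀ (Z : Scheme.{0}) [IsIntegral Z] (ρZ : G →* Aut Z) (u : X₁ ⟶ Z) [IsDominant u]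
      (v : Z ⟶ X), IsSandwichModel p n ρ π ρZ u v →
      ∃ 𝒜 : LogAtlas.{0} Z, 𝒜.IsLogRegular ∧ IsLogEquivariant 𝒜 ρZ) :
    GaloisQuotientModels :=
  galoisQuotientModels_of_illusieTemkin2014_of_multiplicativeDefect
    IllusieTemkin2014_equivariantLogRegularResolution_holds hMD

/-- **(MD) gives a separable Galois top, scheme by scheme, unconditionally.** For `X` integral,
separated of finite type over a field of characteristic `p`, with finite subsets in affine opens: a
de Jong datum of exponent `n` all of whose normal level-`n` sandwich models are `G`-equivariantly
log regular yields a regular SEPARABLE Galois top of `X` — the calibration theorem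
`hasSeparableGaloisTop_of_multiplicativeDefect_of_equivariantLogResolution` with its hypothesis
(ELR) discharged by `stub_equivariantLogResolution`. Together with
`multiplicativeDefect_of_hasSeparableGaloisTop`: (MD) for `X` ⟺ a separable Galois top of `X`.
[cite: DeJong1997, 5.3 and Thm. 5.13] [cite: AbramovichOort2000, Question 2.13] -/
theorem hasSeparableGaloisTop_of_multiplicativeDefect
    (p : ℕ) [Fact p.Prime] (k : Type) [Field k] [CharP k p] (X : Scheme.{0}) [IsIntegral X]
    (f : X ⟶ Spec (.of k)) [IsSeparated f] [LocallyOfFiniteType f] [QuasiCompact f]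
    (hXaff : ∀ S : Finset X, ∃ U : X.Opens, IsAffineOpen U ∧ (↑S : Set X) ⊆ U)
    (hMD : ∃ (G : Type) (_ : Group G) (_ : Finite G) (X₁ : Scheme.{0}) (_ : IsIntegral X₁)
      (ρ : G →* Aut X₁) (π : X₁ ⟶ X) (_ : IsDominant π) (n : ℕ),
      IsGaloisAlterationOfExponent p n ρ π ∧
      ∀ (Z : Scheme.{0}) [IsIntegral Z] (ρZ : G →* Aut Z) (u : X₁ ⟶ Z) [IsDominant u]
      (v : Z ⟶ X), IsSandwichModel p n ρ π ρZ u v →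
      ∃ 𝒜 : LogAtlas.{0} Z, 𝒜.IsLogRegular ∧ IsLogEquivariant 𝒜 ρZ) :
    HasSeparableGaloisTop X :=
  hasSeparableGaloisTop_of_multiplicativeDefect_of_equivariantLogResolution p k X f hXaff hMD
    (fun Z _ _ 𝒜 G _ _ ρZ h𝒜 heqv haff => stub_equivariantLogResolution Z 𝒜 G ρZ h𝒜 heqv haff)

end Summit.ResolutionOfSingularities.ResolutionOfSingularities.Theorems.GaloisQuotientModels

end
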